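import Summits.QuantumFields.BalabanUV.T4Continuum.Spine.NE1p.DressedWindowScheduleWin
import Summits.QuantumFields.BalabanUV.T4Continuum.Spine.NE1p.DressedUniformConstants

/-!
# T⁴ programme, spine estimate NE1′ (node O3b/H2) — ROW S3 ∘ ROW S1d: THE PER-CUTOFF BUNDLE OVER THE CUTOFF-FREE-WINDOW END
# (END-F-win, `hP` DISPLAYED) and (w4) discharged by a K-free ratio (swarm item S3g «window face» of `t4/formal/NE1p/LEAVES.md` v2.3;
# INTENT CLAIMS.log l.9592, relabelled S3f → S3g l.9664)

Cell `pub-balaban`, sub-cell `t4`, BINDER-OWNERS row NE1′, formalisation crew `b2b-balaban-t4-ne1p-formalise-*`, seat `…-leaf-09`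
(gen 2; holder of rows S3 `DressedUniformConstants` p212599, S3b `DressedTransportUniform` p213094, S3-sup `DressedUniformConstantsOf`
p213131, S3d `DressedTransportRatioScheduled` p213257).  ADDITIVE — imports `Spine/NE1p/DressedWindowScheduleWin` (row S1d, leaf-04:
`WindowScheduleWin r w`, `transportLeaf_win_of_schedule`, the cutoff-free witness `WindowScheduleWin.geometric`, p213367) and
`Spine/NE1p/DressedUniformConstants` (row S3: `alphaCell`, `hdom_cell`, `uniformConstantsCell`, `bookingLeavesCell`,
`dressedStability_of_cell`) ONLY; modifies nothing.

WHAT THIS FILE DOES (the sibling of row S3b = S3 ∘ S1b and row S3d = S3 ∘ S2c ∘ S1 for the PER-STEP-WINDOW END).  Leaf-08's END-F-win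
(`DressedRootWin.transportLeaf_of_centredExponent_win`, p213121) asks the nesting (N2) only for chart motions below a per-step window,
and leaf-04's row S1d discharges its window geometry from a `W : WindowScheduleWin r w` whose witness `geometric` has a FINITE,
CUTOFF-FREE birth window (`geometric_birthWindow`, `geometric_window_ge∕le`).  S1d's END `transportLeaf_win_of_schedule` still displays
the step-factor profile `α` (`hα`) and (w4) `hdom : ∀ k, k+1 ≤ B.K → e³·(1 + 4·(2σ k)∕ϱc k) ≤ α k`.  Here:
* §1 `κ_nonneg_of_ratio₀`∕`κ_nonneg_win`, **`hdom_of_seqRatio`** (stated once for bare radius sequences) — under a DISPLAYED K-free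
  diameter∕radius ratio `hratio : ∀ k, 2σ k ≤ κ·ϱc k`
  S1d's `hdom` holds VERBATIM with the CONSTANT profile `α := fun _ => alphaCell κ = e³(1+4κ)` (row S3's `hdom_cell` BY NAME); the
  witness `geometric` inhabits `hratio` with `κ = 2σ₀∕ϱ₀` at EVERY step (`geometric_ratio_κ`, §4; X(S1d) INFO-1, CLAIMS.log l.9652).
* §2 **`transportLeaf_win_uniform_of_schedule`** — S1d's END with `hα`∕`hdom` DISCHARGED; conclusion VERBATIM the field type of
  `BookingLeaves.htr` at `C = 4c_δ∕r`, `ρ i = ψ·alphaCell κ`.  Displayed: (w1) `hsl` on the window `bondBall d (W.ρw k′)`, H2 `hFn`∕`h𝒢`,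
  (w2-act) `hB`∕`hE` (printed TYPE [Balaban1989LargeFieldII] (1.65) p. 375, (1.71)–(1.75) pp. 379–380 — asserted for Bałaban's
  densities NOWHERE), **F-4 `hP` (the centred perturbation slice of the observable-attached exponent — DISPLAYED: this is the
  END-F-win face, NOT the assembled END-F′)**, `hDμ`, (I4′) `hdefwk : defect b k′ k ≤ W.wc k` (per-step chart window — an ABSOLUTE-step
  guard, X(S1d) INFO-2) ∕ `hrate`, attainment `hlin`, invariance `hinv`, scalars `hr`, and `hratio`.
* §3 **`bookingLeaves_win_of_schedule : BookingLeaves (uniformConstantsCell L (4c_δ∕r) c̄ κ N₀ A₀ m s̄⁰ ρ′ …) B T`** at the cell's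
  transverse rate `ψ := L⁻²` (F-6's READING, caveat k3 — a parameter choice): the per-cutoff input of END-B with `htr` := §2 and (w7)
  `hρ`∕`hc`∕`hrate` discharged by row S3 (`bookingLeavesCell`); displayed in addition (w5) `hreg` with `0 ≤ creg k ≤ c̄`, (w2-act) `hs₀`,
  (w3-book) `hS`∕`hcount` at rate `L⁴` (row S4's instance), (w1)+(w5b) `hbirth` (row S5's suppliers), row S3's located scalars
  `1 ≤ L`, `locCell L (4c_δ∕r) c̄ κ ≤ ρ′ < 1` ((w7)), `m·(N₀A₀(1−ρ′)⁻¹) ≤ 1 − s̄⁰` ((w6)); `dressedStability_win_of_cell` = END-B BY NAME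
  on `∀ p K` of §3's bundles (the all-cutoff face with the families spelled out is the sibling module `DressedStabilityOfWinSchedules`).
* §4 the instance on the cutoff-free witness: `geometric_ratio_κ`, `hdom_win_geometric`, `transportLeaf_win_geometric` (κ := 2σ₀∕ϱ₀).

LOCATED CAVEATS CARRIED (typer R-T26 ∕ DAG §3b).  LF-2 = F-ne1pleaf04-1: the windows here are CUTOFF-FREE **WITH `hP` DISPLAYED**;
assembling `hP` (END-F′ ∕ END-F′-mod-win) re-introduces the uniform SLICE window `w` once per met step through `hN2cx`∕`hpairx`
(birth window ≥ K·w) until leaf-04's row S1e «slice-win» lands — then the same composition over it is the assembled sibling.  X(S1d)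
INFO-2: the schedule is ABSOLUTE-step indexed, so `hdefwk` asks `defect b k′ k ≤ wc k` of EVERY generation (along `geometric`:
`≤ 2σ₀q^k`) — an absolute decay NOT implied by F-6's displayed relative rate `c_δψ^{k−k′}`; both stay displayed; which frame the
instantiated defects live in is the owner's §F∕§G question.  LF-1's FLOOR half is absent (no floor anywhere here).

HONEST FRAMING.  Kernel composition over hypothesis shapes ([folklore]; 0 sorry; 0 citations used as facts; no `def … : Prop`).
Headline: «BookingLeaves ∕ NE1′-per-cutoff ⇐ the DISPLAYED wall binders incl. F-4 `hP` + located largeness + a ratio-bounded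
per-step-window schedule (cutoff-free windows available)», NEVER «NE1′ proved»; 0 leaves instantiated on Bałaban's densities; the wall
(w1), (w2-act) THE NUMBER, F-4, (w3)⁺, (w5), (w6), (w7)'s located largeness, F-6's rate stands; spine PROVED 0∕9.  Rung (B)+1 on ONE
finite four-torus — NOT infinite volume, NOT a mass gap, NOT OS on ℝ⁴, NOT Clay.  HONEST DEPENDENCY: continuum YM on T⁴ ⇐ BetaPertH ∧
nine spine estimates (0/9 proved); BetaPertH ⇐ (D1) ∧ (D4) ∧ CAP+tail; G-an2-4 gates asym, D1 and NE2/3/4.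
-/

noncomputable section

namespace Summit.QuantumFields.BalabanUV.T4Continuum.NE1p.DressedTransportUniformWin

open MeasureTheory Set Metric Finset
open scoped BigOperators
open Literature.MathematicalPhysics.QuantumFieldTheory.Balaban1983to89
open Literature.MathematicalPhysics.QuantumFieldTheory.Balaban1983to89.T4TermFormat
open Literature.MathematicalPhysics.QuantumFieldTheory.Balaban1983to89.T4GatedBooking
open Literature.MathematicalPhysics.QuantumFieldTheory.Balaban1983to89.T4TrajectoryComparison
open Literature.MathematicalPhysics.QuantumFieldTheory.Balaban1983to89.T4TrajectoryModulus
open T4BirthChartTransport (GaugeInvariant BirthSlice RelGauge)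
open T4BlockTransport (Fld NDir latMove latN)
open T4TrajectoryDensity
open Summit.QuantumFields.BalabanUV.T4Continuum.T4TrajectoryDensityDressed
open Summit.QuantumFields.BalabanUV.T4Continuum.NE1p.DressedRoot
open Summit.QuantumFields.BalabanUV.T4Continuum.NE1p.DressedWindowScheduleWin
open Summit.QuantumFields.BalabanUV.T4Continuum.NE1p.DressedUniformConstants

/-! ## §1 (w4) from a K-free diameter∕radius ratio — stated once for bare radius SEQUENCES
(so that it serves `WindowScheduleWin` here exactly as rows S3b∕S3d serve `WindowSchedule`, without restating their lemmas) -/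

section Ratio

/-- A ratio bound `2σ₀ ≤ κ·ϱ₀` between a positive diameter and a positive radius forces `κ ≥ 0`. [folklore] -/
theorem κ_nonneg_of_ratio₀ {σ0 ϱ0 κ : ℝ} (hσ : 0 < σ0) (hϱ : 0 < ϱ0) (h0 : 2 * σ0 ≤ κ * ϱ0) : 0 ≤ κ :=
  le_of_not_gt fun h => (not_le.mpr ((mul_neg_of_neg_of_pos h hϱ).trans (by linarith))) h0

/-- **(w4) IN THE PER-STEP INDEXING FROM A K-FREE RATIO OF SEQUENCES** [arith]: for fluctuation radii `σ k` and positive chart radii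
`ϱc k` with `2σ k ≤ κ·ϱc k` at every step, the binder `hdom : ∀ k, k+1 ≤ B.K → e³·(1 + 4·(2σ k)∕ϱc k) ≤ α k` of row S1d's END (and
of row S1's) holds VERBATIM with the CONSTANT profile `α := fun _ => alphaCell κ` (row S3's `hdom_cell`).  The ratio is a displayed
binder; `κ` is a K-free number. [folklore] -/
theorem hdom_of_seqRatio {B : T4TermFormat.Booking} {σ ϱc : ℕ → ℝ} {κ : ℝ} (hϱc : ∀ k, 0 < ϱc k)
    (hratio : ∀ k, 2 * σ k ≤ κ * ϱc k) :
    ∀ k, k + 1 ≤ B.K → Real.exp 3 * (1 + 4 * (2 * σ k) / ϱc k) ≤ (fun _ : ℕ => alphaCell κ) k :=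
  fun k _ => hdom_cell (hϱc k) (hratio k)

/-- The constant profile `fun _ => alphaCell κ` is nonnegative for `κ ≥ 0` (the END's `hα`). [folklore] -/
theorem hα_const {κ : ℝ} (hκ : 0 ≤ κ) : ∀ i : ℕ, 0 ≤ (fun _ : ℕ => alphaCell κ) i :=
  fun _ => alphaCell_nonneg hκ

variable {r w : ℝ} (W : WindowScheduleWin r w)

/-- For a per-step-window schedule, a ratio bound at step 0 already gives `κ ≥ 0`. [folklore] -/
theorem κ_nonneg_win {κ : ℝ} (hratio : ∀ k, 2 * W.σ k ≤ κ * W.ϱc k) : 0 ≤ κ :=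
  κ_nonneg_of_ratio₀ (W.hσ 0) (W.hϱc 0) (hratio 0)

end Ratio

/-! ## §2 END-F-win under the schedule with (w4) discharged -/

section FunctionLevel

variable {r w : ℝ} (W : WindowScheduleWin r w)
variable {B : T4TermFormat.Booking} {T : Trajectory B}
variable {R : Type*} [NormedRing R] [NormedAlgebra ℂ R] [MeasurableSpace R] {d : ℕ}
  {F : Type*} [NormedAddCommGroup F] [NormedSpace ℂ F] [CompleteSpace F]

/-- **END-F-win UNDER A RATIO-BOUNDED PER-STEP-WINDOW SCHEDULE — NO WINDOW GEOMETRY, NO (w4) BINDER** [bookkeeping]: row S1d's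
`DressedWindowScheduleWin.transportLeaf_win_of_schedule` (windows `bondBall d (ρw k)`, fluctuation domains `bondBall d (σ k)`,
diameters `2σ k`, chart radii `ϱc k`, chart windows `wc k` read off `W`) with the step-factor profile FIXED to the K-free constant
`α := fun _ => alphaCell κ` for a displayed ratio bound `hratio : ∀ k, 2σ k ≤ κ·ϱc k` (§1).  Displayed (wall ∕ context only): (w1)
`hsl`; H2 `hFn`∕`h𝒢`; (w2-act) `hB`∕`hE`; F-4 `hP` (the perturbation slice of the observable-attached exponent with size
`m·Σ_{f ∈ S k b} envVar … f k` — DISPLAYED, not assembled); `hDμ`; (I4′) `hdefwk` (per-step, absolute-step guard) ∕ `hrate`; attainment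
`hlin`; invariance; `hr`.  Conclusion: VERBATIM the field type of `BookingLeaves.htr` with `C = 4c_δ∕r`, `ρ i = ψ·alphaCell κ`.
LF-2: cutoff-free windows are available for THIS face (hP displayed) only. [folklore] -/
theorem transportLeaf_win_uniform_of_schedule {κ : ℝ} {Fn : B.Birth → ℕ → ℕ → Fld d R → F}
    {rel : B.Birth → ℕ → ℕ → Fld d R → Fld d R → Prop}
    {ref : B.Birth → ℕ → Fld d R → Fld d R} {base : B.Birth → ℕ → Fld d R → ℝ}
    {𝒜 𝒬 : B.Birth → ℕ → Fld d R → Fld d R → ℂ} {q : B.Birth → ℕ → Fld d R → ℂ}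
    {μ : B.Birth → ℕ → Measure (Fld d R)} {z₀ : B.Birth → ℕ → Fld d R}
    {defect : B.Birth → ℕ → ℕ → ℝ} {cδ ψ m : ℝ} {s : B.Birth → ℕ → ℝ}
    {S : ℕ → B.Birth → Finset B.Birth}
    (hratio : ∀ k, 2 * W.σ k ≤ κ * W.ϱc k) (hr : 0 < r)
    (hsl : ∀ (b : B.Birth) (k' : ℕ), B.birthScale b ≤ k' → k' ≤ B.K →
      RanBelow (budgetGate T s m S (4 * cδ / r) (fun i => ψ * (fun _ : ℕ => alphaCell κ) i)) k' →
      BirthSlice (Fn b k' k') latMove latN (bondBall d (W.ρw k') : Set (Fld d R)) w r (T.gen b k'))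
    (hFn : ∀ (b : B.Birth) (k' k : ℕ), B.birthScale b ≤ k' → k' ≤ k → k + 1 ≤ B.K →
      RanBelow (budgetGate T s m S (4 * cδ / r) (fun i => ψ * (fun _ : ℕ => alphaCell κ) i)) (k + 1) →
      ∀ U, Fn b k' (k + 1) U =
        wOp (expWeight (base b k) (𝒜 b k + 𝒬 b k)) (μ b k) (z₀ b k) U (fun z => Fn b k' k (U + z)))
    (h𝒢 : ∀ (b : B.Birth) (k' k : ℕ), B.birthScale b ≤ k' → k' ≤ k → k + 1 ≤ B.K →
      RanBelow (budgetGate T s m S (4 * cδ / r) (fun i => ψ * (fun _ : ℕ => alphaCell κ) i)) (k + 1) →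
      ∀ U, (fun z => Fn b k' k (U + z)) ∈ BddClass F (μ b k))
    (hB : ∀ (b : B.Birth) (k' k : ℕ), B.birthScale b ≤ k' → k' ≤ k → k + 1 ≤ B.K →
      RanBelow (budgetGate T s m S (4 * cδ / r) (fun i => ψ * (fun _ : ℕ => alphaCell κ) i)) (k + 1) →
      RealBaseAt (ref b k) (base b k) (𝒜 b k) (μ b k) (bondBall d (W.ρw (k + 1)) : Set (Fld d R)))
    (hE : ∀ (b : B.Birth) (k' k : ℕ), B.birthScale b ≤ k' → k' ≤ k → k + 1 ≤ B.K →
      RanBelow (budgetGate T s m S (4 * cδ / r) (fun i => ψ * (fun _ : ℕ => alphaCell κ) i)) (k + 1) →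
      ExponentSliceAt (ref b k) (𝒜 b k) (μ b k) latMove latN (bondBall d (W.ρw (k + 1)) : Set (Fld d R)) w (W.ϱc k)
        (s b k))
    (hP : ∀ (b : B.Birth) (k' k : ℕ), B.birthScale b ≤ k' → k' ≤ k → k + 1 ≤ B.K →
      RanBelow (budgetGate T s m S (4 * cδ / r) (fun i => ψ * (fun _ : ℕ => alphaCell κ) i)) (k + 1) →
      PertSlice (fun U z => 𝒬 b k U z - q b k U) (μ b k) latMove latN (bondBall d (W.ρw (k + 1)) : Set (Fld d R)) w
        (W.ϱc k) (m * ∑ f ∈ S k b, T.envVar (4 * cδ / r) (fun i => ψ * (fun _ : ℕ => alphaCell κ) i) f k))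
    (hDμ : ∀ b k, ∀ᵐ z ∂μ b k, z ∈ (bondBall d (W.σ k) : Set (Fld d R)))
    (hinv : ∀ b k' k, GaugeInvariant (rel b k' k) (Fn b k' k))
    (hdefwk : ∀ (_b : B.Birth) (_k' k : ℕ), defect _b _k' k ≤ W.wc k)
    (hrate : ∀ (b : B.Birth) (k' k : ℕ), B.birthScale b ≤ k' → k' ≤ k → k ≤ B.K →
      defect b k' k ≤ cδ * ψ ^ (k - k'))
    (hlin : ∀ (b : B.Birth) (k' k : ℕ), B.birthScale b ≤ k' → k' ≤ k → k ≤ B.K →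
      RanBelow (budgetGate T s m S (4 * cδ / r) (fun i => ψ * (fun _ : ℕ => alphaCell κ) i)) k → ∀ ε > 0,
      ∃ U₀ ∈ (bondBall d (W.ρw k) : Set (Fld d R)), ∃ U₁ : Fld d R,
        RelGauge (rel b k' k) latMove latN U₀ U₁ (defect b k' k) ∧
        T.lin b k' k ≤ ‖Fn b k' k U₁ - Fn b k' k U₀‖ + ε) :
    T.TransportsFromVar (4 * cδ / r) (fun i => ψ * (fun _ : ℕ => alphaCell κ) i)
      (budgetGate T s m S (4 * cδ / r) (fun i => ψ * (fun _ : ℕ => alphaCell κ) i)) :=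
  transportLeaf_win_of_schedule W (hα_const (κ_nonneg_win W hratio)) hr hsl hFn h𝒢 hB hE hP hDμ
    (hdom_of_seqRatio W.hϱc hratio) hinv hdefwk hrate hlin

end FunctionLevel

/-! ## §3 The per-cutoff face: `BookingLeaves` over the uniform constants, and END-B by name -/

section Bundle

variable {r w : ℝ} (W : WindowScheduleWin r w)
variable {B : T4TermFormat.Booking} {T : Trajectory B}
variable {R : Type*} [NormedRing R] [NormedAlgebra ℂ R] [MeasurableSpace R] {d : ℕ}
  {F : Type*} [NormedAddCommGroup F] [NormedSpace ℂ F] [CompleteSpace F]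

/-- **THE PER-CUTOFF BUNDLE OVER THE WINDOW FACE** [bookkeeping]: at the cell's transverse rate `ψ := L⁻²` (F-6's reading — a
parameter choice) and the K-∕μ-free constants `U := uniformConstantsCell L (4c_δ∕r) c̄ κ N₀ A₀ m s̄⁰ ρ′` of row S3, the leaf binders
`BookingLeaves U B T` of END-B with T `htr` DISCHARGED by §2 (END-F-win under the schedule — `hP` displayed, no window geometry, no
(w4)) and (w7) `hrate`∕`hρ`∕`hc` DISCHARGED by row S3.  DISPLAYED, per cutoff: §2's wall ∕ context binders (incl. F-4 `hP` and
`hratio`); (w5) `hreg` with `0 ≤ creg k ≤ c̄`; (w2-act) `hs₀ : s b k ≤ s̄⁰`; (w3-book) `hS`∕`hcount` at rate `L⁴` (row S4's instance);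
(w1)+(w5b) `hbirth` in the class `twoRate A₀ (rhoOne L⁻² (4c_δ∕r) c̄ κ) L⁻³ K` (row S5's suppliers); row S3's located scalars
`1 ≤ L`, `locCell L (4c_δ∕r) c̄ κ ≤ ρ′ < 1` ((w7)), `m·(N₀A₀(1−ρ′)⁻¹) ≤ 1 − s̄⁰` ((w6)).  The schedule's birth window is whatever `W`
says — cutoff-free for `WindowScheduleWin.geometric` (LF-2: for THIS face).  Feed `∀ p K` of it to END-B (`dressedStability_win_of_cell`).
Nothing of Bałaban's densities asserted. [folklore] -/
def bookingLeaves_win_of_schedule {κ L cbar N₀ A₀ sbar ρ' : ℝ} {Fn : B.Birth → ℕ → ℕ → Fld d R → F}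
    {rel : B.Birth → ℕ → ℕ → Fld d R → Fld d R → Prop}
    {ref : B.Birth → ℕ → Fld d R → Fld d R} {base : B.Birth → ℕ → Fld d R → ℝ}
    {𝒜 𝒬 : B.Birth → ℕ → Fld d R → Fld d R → ℂ} {q : B.Birth → ℕ → Fld d R → ℂ}
    {μ : B.Birth → ℕ → Measure (Fld d R)} {z₀ : B.Birth → ℕ → Fld d R}
    {defect : B.Birth → ℕ → ℕ → ℝ} {cδ m : ℝ} {s : B.Birth → ℕ → ℝ}
    {S : ℕ → B.Birth → Finset B.Birth} {creg : ℕ → ℝ}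
    -- the schedule's K-free diameter∕radius ratio
    (hratio : ∀ k, 2 * W.σ k ≤ κ * W.ϱc k)
    -- row S3's located scalars ((w7) largeness, (w6) window) and signs
    (hL : 1 ≤ L) (hcbar : 0 ≤ cbar) (hN₀ : 0 ≤ N₀) (hA₀ : 0 ≤ A₀) (hm : 0 ≤ m)
    (hloc : locCell L (4 * cδ / r) cbar κ ≤ ρ') (hρ'1 : ρ' < 1)
    (hsmall : m * (N₀ * A₀ * (1 - ρ')⁻¹) ≤ 1 - sbar)
    -- scalars of the END
    (hr : 0 < r) (hcδ : 0 ≤ cδ)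
    -- END-F-win's wall ∕ context binders at ψ := L⁻², α := alphaCell κ
    (hsl : ∀ (b : B.Birth) (k' : ℕ), B.birthScale b ≤ k' → k' ≤ B.K →
      RanBelow (budgetGate T s m S (4 * cδ / r) (fun i => (L ^ 2)⁻¹ * (fun _ : ℕ => alphaCell κ) i)) k' →
      BirthSlice (Fn b k' k') latMove latN (bondBall d (W.ρw k') : Set (Fld d R)) w r (T.gen b k'))
    (hFn : ∀ (b : B.Birth) (k' k : ℕ), B.birthScale b ≤ k' → k' ≤ k → k + 1 ≤ B.K →
      RanBelow (budgetGate T s m S (4 * cδ / r) (fun i => (L ^ 2)⁻¹ * (fun _ : ℕ => alphaCell κ) i)) (k + 1) →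
      ∀ U, Fn b k' (k + 1) U =
        wOp (expWeight (base b k) (𝒜 b k + 𝒬 b k)) (μ b k) (z₀ b k) U (fun z => Fn b k' k (U + z)))
    (h𝒢 : ∀ (b : B.Birth) (k' k : ℕ), B.birthScale b ≤ k' → k' ≤ k → k + 1 ≤ B.K →
      RanBelow (budgetGate T s m S (4 * cδ / r) (fun i => (L ^ 2)⁻¹ * (fun _ : ℕ => alphaCell κ) i)) (k + 1) →
      ∀ U, (fun z => Fn b k' k (U + z)) ∈ BddClass F (μ b k))
    (hB : ∀ (b : B.Birth) (k' k : ℕ), B.birthScale b ≤ k' → k' ≤ k → k + 1 ≤ B.K →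
      RanBelow (budgetGate T s m S (4 * cδ / r) (fun i => (L ^ 2)⁻¹ * (fun _ : ℕ => alphaCell κ) i)) (k + 1) →
      RealBaseAt (ref b k) (base b k) (𝒜 b k) (μ b k) (bondBall d (W.ρw (k + 1)) : Set (Fld d R)))
    (hE : ∀ (b : B.Birth) (k' k : ℕ), B.birthScale b ≤ k' → k' ≤ k → k + 1 ≤ B.K →
      RanBelow (budgetGate T s m S (4 * cδ / r) (fun i => (L ^ 2)⁻¹ * (fun _ : ℕ => alphaCell κ) i)) (k + 1) →
      ExponentSliceAt (ref b k) (𝒜 b k) (μ b k) latMove latN (bondBall d (W.ρw (k + 1)) : Set (Fld d R)) w (W.ϱc k)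
        (s b k))
    (hP : ∀ (b : B.Birth) (k' k : ℕ), B.birthScale b ≤ k' → k' ≤ k → k + 1 ≤ B.K →
      RanBelow (budgetGate T s m S (4 * cδ / r) (fun i => (L ^ 2)⁻¹ * (fun _ : ℕ => alphaCell κ) i)) (k + 1) →
      PertSlice (fun U z => 𝒬 b k U z - q b k U) (μ b k) latMove latN (bondBall d (W.ρw (k + 1)) : Set (Fld d R)) w
        (W.ϱc k) (m * ∑ f ∈ S k b, T.envVar (4 * cδ / r) (fun i => (L ^ 2)⁻¹ * (fun _ : ℕ => alphaCell κ) i) f k))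
    (hDμ : ∀ b k, ∀ᵐ z ∂μ b k, z ∈ (bondBall d (W.σ k) : Set (Fld d R)))
    (hinv : ∀ b k' k, GaugeInvariant (rel b k' k) (Fn b k' k))
    (hdefwk : ∀ (_b : B.Birth) (_k' k : ℕ), defect _b _k' k ≤ W.wc k)
    (hrate : ∀ (b : B.Birth) (k' k : ℕ), B.birthScale b ≤ k' → k' ≤ k → k ≤ B.K →
      defect b k' k ≤ cδ * ((L ^ 2)⁻¹) ^ (k - k'))
    (hlin : ∀ (b : B.Birth) (k' k : ℕ), B.birthScale b ≤ k' → k' ≤ k → k ≤ B.K →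
      RanBelow (budgetGate T s m S (4 * cδ / r) (fun i => (L ^ 2)⁻¹ * (fun _ : ℕ => alphaCell κ) i)) k →
      ∀ ε > 0, ∃ U₀ ∈ (bondBall d (W.ρw k) : Set (Fld d R)), ∃ U₁ : Fld d R,
        RelGauge (rel b k' k) latMove latN U₀ U₁ (defect b k' k) ∧
        T.lin b k' k ≤ ‖Fn b k' k U₁ - Fn b k' k U₀‖ + ε)
    -- the booking-level wall binders: (w5) regeneration, (w2-act) margin, (w3-book) counts, (w1)+(w5b) births
    (hc0 : ∀ k, 0 ≤ creg k) (hcb : ∀ k, k < B.K → creg k ≤ cbar)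
    (hreg : T.RegeneratesFromVar creg
      (budgetGate T s m S (4 * cδ / r) (fun _ : ℕ => (L ^ 2)⁻¹ * alphaCell κ)))
    (hs₀ : ∀ b k, s b k ≤ sbar)
    (hS : ∀ k b, ∀ f ∈ S k b, B.birthScale f ≤ k)
    (hcount : ∀ k b, ∀ j ≤ k, (((S k b).filter fun f => B.birthScale f = j).card : ℝ) ≤ N₀ * (L ^ 4) ^ (k - j))
    (hbirth : T.BirthsFromOld (4 * cδ / r) (fun _ : ℕ => (L ^ 2)⁻¹ * alphaCell κ)
      (twoRate A₀ (rhoOne (L ^ 2)⁻¹ (4 * cδ / r) cbar κ) (L⁻¹ ^ 3) B.K)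
      (budgetGate T s m S (4 * cδ / r) (fun _ : ℕ => (L ^ 2)⁻¹ * alphaCell κ))) :
    BookingLeaves (uniformConstantsCell L (4 * cδ / r) cbar κ N₀ A₀ m sbar ρ' hL
      (div_nonneg (mul_nonneg (by norm_num) hcδ) hr.le) hcbar (κ_nonneg_win W hratio) hN₀ hA₀ hm hloc hρ'1 hsmall) B T :=
  bookingLeavesCell hL (div_nonneg (mul_nonneg (by norm_num) hcδ) hr.le) hcbar (κ_nonneg_win W hratio) hN₀ hA₀ hm hloc hρ'1
    hsmall creg s S hc0 hcb hS hcount hs₀ hbirth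
    (transportLeaf_win_uniform_of_schedule W hratio hr hsl hFn h𝒢 hB hE hP hDμ hinv hdefwk hrate hlin)
    hreg

/-- **END-B OVER §3's BUNDLES** [bookkeeping]: ONE set of the twelve displayed scalars and, at EVERY run parameter `p` and cutoff `K`,
a bundle of §3's type over the SAME `uniformConstantsCell …` ⟹ `DressedStability 𝒯` — row S3's `dressedStability_of_cell` BY NAME
(the `hκ` proof inside the constants is irrelevant by proof-irrelevance, so bundles built by `bookingLeaves_win_of_schedule` from
DIFFERENT schedules `W p K` all have this type).  The sibling `DressedStabilityOfWinSchedules` spells the families out.  «NE1′ ⇐ the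
named binders»; nothing instantiated on Bałaban's densities. [folklore] -/
theorem dressedStability_win_of_cell {P : Type*} (𝒯 : DressedTower P) {κ L cbar N₀ A₀ sbar ρ' cδ m : ℝ} (hL : 1 ≤ L)
    (hcbar : 0 ≤ cbar) (hκ : 0 ≤ κ) (hN₀ : 0 ≤ N₀) (hA₀ : 0 ≤ A₀) (hm : 0 ≤ m)
    (hloc : locCell L (4 * cδ / r) cbar κ ≤ ρ') (hρ'1 : ρ' < 1) (hsmall : m * (N₀ * A₀ * (1 - ρ')⁻¹) ≤ 1 - sbar)
    (hr : 0 < r) (hcδ : 0 ≤ cδ)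
    (leaves : ∀ p K, BookingLeaves (uniformConstantsCell L (4 * cδ / r) cbar κ N₀ A₀ m sbar ρ' hL
      (div_nonneg (mul_nonneg (by norm_num) hcδ) hr.le) hcbar hκ hN₀ hA₀ hm hloc hρ'1 hsmall) (𝒯.B p K) (𝒯.T p K)) :
    DressedStability 𝒯 :=
  dressedStability_of_cell 𝒯 hL (div_nonneg (mul_nonneg (by norm_num) hcδ) hr.le) hcbar hκ hN₀ hA₀ hm hloc hρ'1 hsmall leaves

end Bundle

/-! ## §4 The instance on the cutoff-free witness (κ := 2σ₀∕ϱ₀) -/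

section Witness

variable {B : T4TermFormat.Booking}

/-- [decided toy] Leaf-04's cutoff-free witness `WindowScheduleWin.geometric r w q σ₀ ϱ₀ ρ∞` INHABITS §1's ratio binder with the
K-free `κ := 2σ₀∕ϱ₀`: `2σ k = 2σ₀q^k ≤ (2σ₀∕ϱ₀)·ϱ₀ = κ·ϱc k` at EVERY step (X(S1d) INFO-1; contrast row S1's
`WindowSchedule.geometric`, whose ratio `2^{k+2}w∕r` is unbounded — X3 INFO-1). [folklore] -/
theorem geometric_ratio_κ {r w q σ₀ ϱ₀ ρinf : ℝ} (hq0 : 0 < q) (hq1 : q < 1) (hσ₀ : 0 < σ₀) (hσ₀w : 2 * σ₀ ≤ w)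
    (hϱ₀ : 0 < ϱ₀) :
    ∀ k, 2 * (WindowScheduleWin.geometric r w q σ₀ ϱ₀ ρinf hq0 hq1 hσ₀ hσ₀w hϱ₀).σ k ≤
      (2 * σ₀ / ϱ₀) * (WindowScheduleWin.geometric r w q σ₀ ϱ₀ ρinf hq0 hq1 hσ₀ hσ₀w hϱ₀).ϱc k := by
  intro k
  show 2 * (σ₀ * q ^ k) ≤ 2 * σ₀ / ϱ₀ * ϱ₀
  rw [div_mul_cancel₀ _ hϱ₀.ne']
  have h : q ^ k ≤ 1 := pow_le_one₀ hq0.le hq1.le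
  nlinarith

/-- [decided toy] Along the cutoff-free witness, (w4) in S1d's indexing holds with the constant profile `α := fun _ => alphaCell (2σ₀∕ϱ₀)`
at EVERY step of EVERY cutoff (the author's `geometric_hdom`, in row S3's vocabulary). [folklore] -/
theorem hdom_win_geometric {r w q σ₀ ϱ₀ ρinf : ℝ} (hq0 : 0 < q) (hq1 : q < 1) (hσ₀ : 0 < σ₀) (hσ₀w : 2 * σ₀ ≤ w)
    (hϱ₀ : 0 < ϱ₀) :
    ∀ k, k + 1 ≤ B.K →
      Real.exp 3 * (1 + 4 * (2 * (WindowScheduleWin.geometric r w q σ₀ ϱ₀ ρinf hq0 hq1 hσ₀ hσ₀w hϱ₀).σ k) /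
        (WindowScheduleWin.geometric r w q σ₀ ϱ₀ ρinf hq0 hq1 hσ₀ hσ₀w hϱ₀).ϱc k) ≤ (fun _ : ℕ => alphaCell (2 * σ₀ / ϱ₀)) k :=
  hdom_of_seqRatio (B := B) (WindowScheduleWin.geometric r w q σ₀ ϱ₀ ρinf hq0 hq1 hσ₀ hσ₀w hϱ₀).hϱc
    (geometric_ratio_κ hq0 hq1 hσ₀ hσ₀w hϱ₀)

/-- [decided toy] The witness's birth window `ρw 0 = ρ∞ + (1+2q)σ₀∕(1−q)` and its ratio constant `2σ₀∕ϱ₀` contain NO cutoff: the SAME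
schedule and the SAME `uniformConstantsCell … (2σ₀∕ϱ₀) …` serve §3 at every `(p, K)` — the (w1) window `bondBall d (ρw k′)` displayed
in `hsl` is then K-free (for this `hP`-displayed face; LF-2). [folklore] -/
theorem geometric_birthWindow_ratio {r w q σ₀ ϱ₀ ρinf : ℝ} (hq0 : 0 < q) (hq1 : q < 1) (hσ₀ : 0 < σ₀) (hσ₀w : 2 * σ₀ ≤ w)
    (hϱ₀ : 0 < ϱ₀) :
    (WindowScheduleWin.geometric r w q σ₀ ϱ₀ ρinf hq0 hq1 hσ₀ hσ₀w hϱ₀).ρw 0 = ρinf + (1 + 2 * q) * σ₀ / (1 - q) ∧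
      (∀ k, ρinf ≤ (WindowScheduleWin.geometric r w q σ₀ ϱ₀ ρinf hq0 hq1 hσ₀ hσ₀w hϱ₀).ρw k) ∧
      0 ≤ 2 * σ₀ / ϱ₀ :=
  ⟨WindowScheduleWin.geometric_birthWindow hq0 hq1 hσ₀ hσ₀w hϱ₀,
    fun k => WindowScheduleWin.geometric_window_ge hq0 hq1 hσ₀ hσ₀w hϱ₀ k, by positivity⟩

end Witness

end Summit.QuantumFields.BalabanUV.T4Continuum.NE1p.DressedTransportUniformWin

end
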